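import Literature.Geometry.DiscreteGeometry.TwoShellIntegerModel

/-!
# NODE g79 «CompressedCut», toward the open leaf NS♭₂ — OPERATOR-NORM TRANSPORT ALGEBRA on tetrahedral triples (fourth brick of the FRAME half)

Route `OverbindingBudget` (Crystallization), crux `RobustDefectLimitWindows` (stmt-AtomisticToContinuum-31280), decomp-a2c lens 4, generation 79, ADDENDUM 7.
Companions: `…CompressedCutScale` (scale ratios), `…CompressedCutDict` (dictionary entries `‖s'·A' w − s·(A v − A v_k)‖ ≤ e`), `…CompressedCutClasses`
(entries preserve distances / inner products exactly), `…CompressedCutTransfer` (tetrahedral unimodular triples; transfer to all pattern points with `3e`).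

DESIGN FINDING for step (F-e) (memo NODE-g79 §5 ADDENDUM 7): frame transport along a first-shell chain must carry an OPERATOR-NORM induction hypothesis
`∀ x, ‖s_k·A_k x − s_i·A_i (R x)‖ ≤ δ·‖x‖` with `R` an EXACT linear isometry; then one step costs `+ (5/2)·e` ADDITIVELY (`transport_compose`,
`op_of_tetra_bound`), whereas re-coordinatising the accumulated map at every step multiplies the error by the coordinate constant each step (×3 per step,
useless after 16 steps).  This file supplies the potential-free algebra of that scheme:

* §1 `inner_eq_half_of_tetra`: two first-shell model vectors at distance `1` have inner product `1/2` (a tetrahedral triple is a unit triple with pairwise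
  inner products `1/2`); `norm_eq_one_of_sqNormInt`;
* §2 `norm_sq_tetra_combo` (the Gram quadratic form `‖Σ cᵢwᵢ‖² = Σ cᵢ² + Σ_{i<j} cᵢcⱼ`) and ★ `l1_le_of_tetra`: `|c₀| + |c₁| + |c₂| ≤ (5/2)·‖c₀w₀ + c₁w₁ + c₂w₂‖`
  (the coordinate constant of a tetrahedral unit triple is `√6 < 5/2`);
* §3 ★ `op_of_tetra_bound`: a linear `M` with `‖M wᵢ‖ ≤ e` on a tetrahedral unit triple has `‖M x‖ ≤ (5/2)·e·‖x‖` on every combination `x = Σ cᵢwᵢ`;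
  `norm_tetra_combo_eq` (equal-coefficient combinations of two tetrahedral unit triples have equal norms — the transport map is isometric);
  ★ `transport_compose`: op-norm transport hypotheses compose ADDITIVELY through an exact isometry; `transport_step` (one step on combinations);
* §4 `linearIndependent_of_tetra`, ★ `exists_coords_of_tetra` (a tetrahedral unit triple is a basis of `ℝ³`: Gram form positive definite + `dim = 3`),
  `op_of_tetra_bound_all` (the operator bound for EVERY `x`);
* §5 ★ `exists_isometry_of_tetra` (two tetrahedral unit triples are related by an EXACT linear isometry `R₁`, via `Basis.constr` + equal Gram forms) and
  ★★ `transport_step_exists`: ONE TRANSPORT STEP — three dictionary inequalities `‖H wᵢ − G uᵢ‖ ≤ e` ⇒ `∃ R₁` exact isometry, `R₁ wᵢ = uᵢ`,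
  `∀ x, ‖H x − G (R₁ x)‖ ≤ (5/2)·e·‖x‖`.

Deps: tree only (`Literature.Geometry.DiscreteGeometry.TwoShellIntegerModel`).  No `instance`, no `notation`, no `set_option`, no new axioms, 0 sorry.
-/

namespace Summit.AtomisticToContinuum.Crystallization.Theorems.OverbindingBudgetAffineCompressedCutOp

open Literature.Geometry.DiscreteGeometry (sqNormInt intVec norm_sq_intVec_div dist_sq_intVec_div)

/-! ## §1  Tetrahedral triples are unit triples with pairwise inner products `1/2` -/

/-- A first-shell model vector has norm `1`. [this file] -/
theorem norm_eq_one_of_sqNormInt {W : Fin 3 → ℤ} (h : sqNormInt W = 18) : ‖(Real.sqrt 18)⁻¹ • intVec W‖ = 1 := by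
  have h2 := norm_sq_intVec_div W
  rw [h] at h2
  have h3 : ‖(Real.sqrt 18)⁻¹ • intVec W‖ ^ 2 = 1 := by rw [h2]; norm_num
  have h4 := norm_nonneg ((Real.sqrt 18)⁻¹ • intVec W)
  nlinarith [h3, h4]

/-- Two first-shell model vectors whose difference is first-shell have inner product `1/2`. [this file] -/
theorem inner_eq_half_of_tetra {V W : Fin 3 → ℤ} (hV : sqNormInt V = 18) (hW : sqNormInt W = 18) (hVW : sqNormInt (V - W) = 18) :
    inner ℝ ((Real.sqrt 18)⁻¹ • intVec V) ((Real.sqrt 18)⁻¹ • intVec W) = 1 / 2 := by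
  have n1 := norm_sq_intVec_div V
  have n2 := norm_sq_intVec_div W
  have d := dist_sq_intVec_div V W
  rw [hV] at n1
  rw [hW] at n2
  rw [hVW, dist_eq_norm, norm_sub_sq_real] at d
  push_cast at n1 n2 d
  linarith

/-! ## §2  The Gram quadratic form of a tetrahedral unit triple and its coordinate constant -/

/-- `‖c₀w₀ + c₁w₁ + c₂w₂‖² = c₀² + c₁² + c₂² + c₀c₁ + c₀c₂ + c₁c₂` for a tetrahedral unit triple. [this file] -/
theorem norm_sq_tetra_combo {w₀ w₁ w₂ : EuclideanSpace ℝ (Fin 3)} (h0 : ‖w₀‖ = 1) (h1 : ‖w₁‖ = 1) (h2 : ‖w₂‖ = 1)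
    (h01 : inner ℝ w₀ w₁ = 1 / 2) (h02 : inner ℝ w₀ w₂ = 1 / 2) (h12 : inner ℝ w₁ w₂ = 1 / 2) (c₀ c₁ c₂ : ℝ) :
    ‖c₀ • w₀ + c₁ • w₁ + c₂ • w₂‖ ^ 2 = c₀ ^ 2 + c₁ ^ 2 + c₂ ^ 2 + c₀ * c₁ + c₀ * c₂ + c₁ * c₂ := by
  have h10 : inner ℝ w₁ w₀ = 1 / 2 := by rw [real_inner_comm]; exact h01
  have h20 : inner ℝ w₂ w₀ = 1 / 2 := by rw [real_inner_comm]; exact h02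
  have h21 : inner ℝ w₂ w₁ = 1 / 2 := by rw [real_inner_comm]; exact h12
  rw [← real_inner_self_eq_norm_sq]
  simp only [inner_add_left, inner_add_right, real_inner_smul_left, real_inner_smul_right]
  simp only [real_inner_self_eq_norm_sq, h0, h1, h2, h01, h02, h12, h10, h20, h21]
  ring

/-- ★ **Coordinate constant of a tetrahedral unit triple**: `|c₀| + |c₁| + |c₂| ≤ (5/2)·‖c₀w₀ + c₁w₁ + c₂w₂‖` (sharp constant `√6`). [this file] -/
theorem l1_le_of_tetra {w₀ w₁ w₂ : EuclideanSpace ℝ (Fin 3)} (h0 : ‖w₀‖ = 1) (h1 : ‖w₁‖ = 1) (h2 : ‖w₂‖ = 1)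
    (h01 : inner ℝ w₀ w₁ = 1 / 2) (h02 : inner ℝ w₀ w₂ = 1 / 2) (h12 : inner ℝ w₁ w₂ = 1 / 2) (c₀ c₁ c₂ : ℝ) :
    |c₀| + |c₁| + |c₂| ≤ 5 / 2 * ‖c₀ • w₀ + c₁ • w₁ + c₂ • w₂‖ := by
  have hN := norm_sq_tetra_combo h0 h1 h2 h01 h02 h12 c₀ c₁ c₂
  have hsq : (|c₀| + |c₁| + |c₂|) ^ 2 ≤ (5 / 2 * ‖c₀ • w₀ + c₁ • w₁ + c₂ • w₂‖) ^ 2 := by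
    rw [mul_pow, hN]
    nlinarith [sq_abs c₀, sq_abs c₁, sq_abs c₂, sq_nonneg (|c₀| - |c₁|), sq_nonneg (|c₀| - |c₂|), sq_nonneg (|c₁| - |c₂|),
      sq_nonneg (c₀ + c₁ + c₂), abs_mul_abs_self c₀]
  have ha : 0 ≤ |c₀| + |c₁| + |c₂| := by positivity
  have hb : 0 ≤ 5 / 2 * ‖c₀ • w₀ + c₁ • w₁ + c₂ • w₂‖ := by positivity
  nlinarith [hsq, ha, hb]

/-! ## §3  Operator bounds and additive composition -/

/-- ★ **Operator bound from a tetrahedral triple.**  A linear `M` with `‖M wᵢ‖ ≤ e` on a tetrahedral unit triple satisfies `‖M x‖ ≤ (5/2)·e·‖x‖` on every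
combination `x = c₀w₀ + c₁w₁ + c₂w₂` (= every `x`, by `…Transfer.model_cramer` / spanning). [this file] -/
theorem op_of_tetra_bound {M : EuclideanSpace ℝ (Fin 3) →ₗ[ℝ] EuclideanSpace ℝ (Fin 3)} {w₀ w₁ w₂ : EuclideanSpace ℝ (Fin 3)}
    (h0 : ‖w₀‖ = 1) (h1 : ‖w₁‖ = 1) (h2 : ‖w₂‖ = 1)
    (h01 : inner ℝ w₀ w₁ = 1 / 2) (h02 : inner ℝ w₀ w₂ = 1 / 2) (h12 : inner ℝ w₁ w₂ = 1 / 2)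
    {e : ℝ} (hM₀ : ‖M w₀‖ ≤ e) (hM₁ : ‖M w₁‖ ≤ e) (hM₂ : ‖M w₂‖ ≤ e) (c₀ c₁ c₂ : ℝ) :
    ‖M (c₀ • w₀ + c₁ • w₁ + c₂ • w₂)‖ ≤ 5 / 2 * e * ‖c₀ • w₀ + c₁ • w₁ + c₂ • w₂‖ := by
  have he : 0 ≤ e := (norm_nonneg _).trans hM₀
  have hl1 := l1_le_of_tetra h0 h1 h2 h01 h02 h12 c₀ c₁ c₂
  have e1 : M (c₀ • w₀ + c₁ • w₁ + c₂ • w₂) = c₀ • M w₀ + c₁ • M w₁ + c₂ • M w₂ := by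
    simp only [map_add, map_smul]
  rw [e1]
  have n1 := norm_add_le (c₀ • M w₀ + c₁ • M w₁) (c₂ • M w₂)
  have n2 := norm_add_le (c₀ • M w₀) (c₁ • M w₁)
  rw [norm_smul, Real.norm_eq_abs] at n1
  rw [norm_smul, norm_smul, Real.norm_eq_abs, Real.norm_eq_abs] at n2
  have p0 := mul_le_mul_of_nonneg_left hM₀ (abs_nonneg c₀)
  have p1 := mul_le_mul_of_nonneg_left hM₁ (abs_nonneg c₁)
  have p2 := mul_le_mul_of_nonneg_left hM₂ (abs_nonneg c₂)
  have p3 := mul_le_mul_of_nonneg_right hl1 he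
  linarith

/-- Equal-coefficient combinations of two tetrahedral unit triples have equal norms: the transport `Σ cᵢwᵢ ↦ Σ cᵢuᵢ` is isometric. [this file] -/
theorem norm_tetra_combo_eq {w₀ w₁ w₂ u₀ u₁ u₂ : EuclideanSpace ℝ (Fin 3)}
    (h0 : ‖w₀‖ = 1) (h1 : ‖w₁‖ = 1) (h2 : ‖w₂‖ = 1)
    (h01 : inner ℝ w₀ w₁ = 1 / 2) (h02 : inner ℝ w₀ w₂ = 1 / 2) (h12 : inner ℝ w₁ w₂ = 1 / 2)
    (g0 : ‖u₀‖ = 1) (g1 : ‖u₁‖ = 1) (g2 : ‖u₂‖ = 1)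
    (g01 : inner ℝ u₀ u₁ = 1 / 2) (g02 : inner ℝ u₀ u₂ = 1 / 2) (g12 : inner ℝ u₁ u₂ = 1 / 2) (c₀ c₁ c₂ : ℝ) :
    ‖c₀ • u₀ + c₁ • u₁ + c₂ • u₂‖ = ‖c₀ • w₀ + c₁ • w₁ + c₂ • w₂‖ := by
  have a := norm_sq_tetra_combo h0 h1 h2 h01 h02 h12 c₀ c₁ c₂
  have b := norm_sq_tetra_combo g0 g1 g2 g01 g02 g12 c₀ c₁ c₂
  have hab : ‖c₀ • u₀ + c₁ • u₁ + c₂ • u₂‖ ^ 2 = ‖c₀ • w₀ + c₁ • w₁ + c₂ • w₂‖ ^ 2 := by rw [a, b]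
  exact (pow_left_inj₀ (norm_nonneg _) (norm_nonneg _) two_ne_zero).mp hab

/-- ★ **ADDITIVE COMPOSITION of op-norm transport.**  If `‖G x − F (R x)‖ ≤ δ·‖x‖` and `‖H x − G (R₁ x)‖ ≤ δ₁·‖x‖` for all `x`, with `R₁` an exact linear
isometry, then `‖H x − F (R (R₁ x))‖ ≤ (δ₁ + δ)·‖x‖` for all `x` — errors ADD along a chain (`F, G, H` = the scaled frames `s_i·A_i, s_k·A_k, s_l·A_l`). [this file] -/
theorem transport_compose {F G H : EuclideanSpace ℝ (Fin 3) →ₗ[ℝ] EuclideanSpace ℝ (Fin 3)}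
    {R : EuclideanSpace ℝ (Fin 3) → EuclideanSpace ℝ (Fin 3)} {R₁ : EuclideanSpace ℝ (Fin 3) →ₗᵢ[ℝ] EuclideanSpace ℝ (Fin 3)} {δ δ₁ : ℝ}
    (hk : ∀ x, ‖G x - F (R x)‖ ≤ δ * ‖x‖) (hl : ∀ x, ‖H x - G (R₁ x)‖ ≤ δ₁ * ‖x‖) :
    ∀ x, ‖H x - F (R (R₁ x))‖ ≤ (δ₁ + δ) * ‖x‖ := by
  intro x
  have h1 := hl x
  have h2 := hk (R₁ x)
  rw [LinearIsometry.norm_map] at h2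
  have e : H x - F (R (R₁ x)) = (H x - G (R₁ x)) + (G (R₁ x) - F (R (R₁ x))) := by abel
  rw [e]
  have h3 := norm_add_le (H x - G (R₁ x)) (G (R₁ x) - F (R (R₁ x)))
  linarith

/-- **One transport step in op-norm form.**  If `M = H − G ∘ R₁` (as values) is bounded by `e` on a tetrahedral unit triple `wᵢ` — i.e. the three dictionary
inequalities `‖H wᵢ − G uᵢ‖ ≤ e` with `R₁ wᵢ = uᵢ` — then `‖H x − G (R₁ x)‖ ≤ (5/2)·e·‖x‖` on every combination `x = Σ cᵢwᵢ`. [this file] -/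
theorem transport_step {G H : EuclideanSpace ℝ (Fin 3) →ₗ[ℝ] EuclideanSpace ℝ (Fin 3)}
    {R₁ : EuclideanSpace ℝ (Fin 3) →ₗᵢ[ℝ] EuclideanSpace ℝ (Fin 3)} {w₀ w₁ w₂ u₀ u₁ u₂ : EuclideanSpace ℝ (Fin 3)}
    (h0 : ‖w₀‖ = 1) (h1 : ‖w₁‖ = 1) (h2 : ‖w₂‖ = 1)
    (h01 : inner ℝ w₀ w₁ = 1 / 2) (h02 : inner ℝ w₀ w₂ = 1 / 2) (h12 : inner ℝ w₁ w₂ = 1 / 2)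
    (hR₀ : R₁ w₀ = u₀) (hR₁ : R₁ w₁ = u₁) (hR₂ : R₁ w₂ = u₂)
    {e : ℝ} (hd₀ : ‖H w₀ - G u₀‖ ≤ e) (hd₁ : ‖H w₁ - G u₁‖ ≤ e) (hd₂ : ‖H w₂ - G u₂‖ ≤ e) (c₀ c₁ c₂ : ℝ) :
    ‖H (c₀ • w₀ + c₁ • w₁ + c₂ • w₂) - G (R₁ (c₀ • w₀ + c₁ • w₁ + c₂ • w₂))‖ ≤ 5 / 2 * e * ‖c₀ • w₀ + c₁ • w₁ + c₂ • w₂‖ := by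
  have key := op_of_tetra_bound (M := H - G ∘ₗ R₁.toLinearMap) h0 h1 h2 h01 h02 h12 (e := e)
    (by simpa [hR₀] using hd₀) (by simpa [hR₁] using hd₁) (by simpa [hR₂] using hd₂) c₀ c₁ c₂
  simpa using key

/-! ## §4  A tetrahedral unit triple is a basis: coordinates, global operator bounds -/

/-- A tetrahedral unit triple is linearly independent (its Gram form `½(Σ cᵢ² + (Σ cᵢ)²)` is positive definite). [this file] -/
theorem linearIndependent_of_tetra {w₀ w₁ w₂ : EuclideanSpace ℝ (Fin 3)} (h0 : ‖w₀‖ = 1) (h1 : ‖w₁‖ = 1) (h2 : ‖w₂‖ = 1)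
    (h01 : inner ℝ w₀ w₁ = 1 / 2) (h02 : inner ℝ w₀ w₂ = 1 / 2) (h12 : inner ℝ w₁ w₂ = 1 / 2) :
    LinearIndependent ℝ ![w₀, w₁, w₂] := by
  rw [Fintype.linearIndependent_iff]
  intro g hg
  have hs : ∑ j, g j • ![w₀, w₁, w₂] j = g 0 • w₀ + g 1 • w₁ + g 2 • w₂ := by
    simp [Fin.sum_univ_three]
  rw [hs] at hg
  have hN := norm_sq_tetra_combo h0 h1 h2 h01 h02 h12 (g 0) (g 1) (g 2)
  rw [hg, norm_zero] at hN
  have q0 : g 0 ^ 2 = 0 := by nlinarith [sq_nonneg (g 0 + g 1 + g 2), sq_nonneg (g 1), sq_nonneg (g 2), sq_nonneg (g 0)]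
  have q1 : g 1 ^ 2 = 0 := by nlinarith [sq_nonneg (g 0 + g 1 + g 2), sq_nonneg (g 1), sq_nonneg (g 2), sq_nonneg (g 0)]
  have q2 : g 2 ^ 2 = 0 := by nlinarith [sq_nonneg (g 0 + g 1 + g 2), sq_nonneg (g 1), sq_nonneg (g 2), sq_nonneg (g 0)]
  intro i
  fin_cases i
  · exact pow_eq_zero_iff (two_ne_zero) |>.mp q0
  · exact pow_eq_zero_iff (two_ne_zero) |>.mp q1
  · exact pow_eq_zero_iff (two_ne_zero) |>.mp q2

/-- `3 = dim ℝ³`, in the form the basis lemmas want. [folklore] -/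
private theorem card_fin_three_eq_finrank : Fintype.card (Fin 3) = Module.finrank ℝ (EuclideanSpace ℝ (Fin 3)) := by
  rw [Fintype.card_fin, finrank_euclideanSpace_fin]

/-- ★ **Coordinates.**  Every vector of `ℝ³` is a real combination of a tetrahedral unit triple. [this file] -/
theorem exists_coords_of_tetra {w₀ w₁ w₂ : EuclideanSpace ℝ (Fin 3)} (h0 : ‖w₀‖ = 1) (h1 : ‖w₁‖ = 1) (h2 : ‖w₂‖ = 1)
    (h01 : inner ℝ w₀ w₁ = 1 / 2) (h02 : inner ℝ w₀ w₂ = 1 / 2) (h12 : inner ℝ w₁ w₂ = 1 / 2) (x : EuclideanSpace ℝ (Fin 3)) :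
    ∃ c₀ c₁ c₂ : ℝ, x = c₀ • w₀ + c₁ • w₁ + c₂ • w₂ := by
  have hli := linearIndependent_of_tetra h0 h1 h2 h01 h02 h12
  have hspan := hli.span_eq_top_of_card_eq_finrank card_fin_three_eq_finrank
  have hx : x ∈ Submodule.span ℝ (Set.range ![w₀, w₁, w₂]) := by rw [hspan]; exact Submodule.mem_top
  obtain ⟨c, hc⟩ := (Submodule.mem_span_range_iff_exists_fun ℝ).1 hx
  refine ⟨c 0, c 1, c 2, ?_⟩
  rw [← hc]
  simp [Fin.sum_univ_three]

/-- ★ **Global operator bound**: `‖M wᵢ‖ ≤ e` on a tetrahedral unit triple ⇒ `‖M x‖ ≤ (5/2)·e·‖x‖` for EVERY `x`. [this file] -/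
theorem op_of_tetra_bound_all {M : EuclideanSpace ℝ (Fin 3) →ₗ[ℝ] EuclideanSpace ℝ (Fin 3)} {w₀ w₁ w₂ : EuclideanSpace ℝ (Fin 3)}
    (h0 : ‖w₀‖ = 1) (h1 : ‖w₁‖ = 1) (h2 : ‖w₂‖ = 1)
    (h01 : inner ℝ w₀ w₁ = 1 / 2) (h02 : inner ℝ w₀ w₂ = 1 / 2) (h12 : inner ℝ w₁ w₂ = 1 / 2)
    {e : ℝ} (hM₀ : ‖M w₀‖ ≤ e) (hM₁ : ‖M w₁‖ ≤ e) (hM₂ : ‖M w₂‖ ≤ e) :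
    ∀ x, ‖M x‖ ≤ 5 / 2 * e * ‖x‖ := by
  intro x
  obtain ⟨c₀, c₁, c₂, rfl⟩ := exists_coords_of_tetra h0 h1 h2 h01 h02 h12 x
  exact op_of_tetra_bound h0 h1 h2 h01 h02 h12 hM₀ hM₁ hM₂ c₀ c₁ c₂

/-! ## §5  The exact isometry between two tetrahedral unit triples, and ONE TRANSPORT STEP -/

/-- ★ **Isometry between tetrahedral unit triples.**  Two tetrahedral unit triples are related by an exact linear isometry of `ℝ³` (the linear map sending
one basis to the other preserves the common Gram form). [this file] -/
theorem exists_isometry_of_tetra {w₀ w₁ w₂ u₀ u₁ u₂ : EuclideanSpace ℝ (Fin 3)}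
    (h0 : ‖w₀‖ = 1) (h1 : ‖w₁‖ = 1) (h2 : ‖w₂‖ = 1)
    (h01 : inner ℝ w₀ w₁ = 1 / 2) (h02 : inner ℝ w₀ w₂ = 1 / 2) (h12 : inner ℝ w₁ w₂ = 1 / 2)
    (g0 : ‖u₀‖ = 1) (g1 : ‖u₁‖ = 1) (g2 : ‖u₂‖ = 1)
    (g01 : inner ℝ u₀ u₁ = 1 / 2) (g02 : inner ℝ u₀ u₂ = 1 / 2) (g12 : inner ℝ u₁ u₂ = 1 / 2) :
    ∃ R : EuclideanSpace ℝ (Fin 3) →ₗᵢ[ℝ] EuclideanSpace ℝ (Fin 3), R w₀ = u₀ ∧ R w₁ = u₁ ∧ R w₂ = u₂ := by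
  have hli := linearIndependent_of_tetra h0 h1 h2 h01 h02 h12
  set B := basisOfLinearIndependentOfCardEqFinrank hli card_fin_three_eq_finrank with hB
  have hBc : ⇑B = ![w₀, w₁, w₂] := coe_basisOfLinearIndependentOfCardEqFinrank hli card_fin_three_eq_finrank
  set T : EuclideanSpace ℝ (Fin 3) →ₗ[ℝ] EuclideanSpace ℝ (Fin 3) := B.constr ℝ ![u₀, u₁, u₂] with hT
  have hTi : ∀ i, T (![w₀, w₁, w₂] i) = ![u₀, u₁, u₂] i := by
    intro i
    have := B.constr_basis ℝ ![u₀, u₁, u₂] i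
    rwa [hBc] at this
  have hT0 : T w₀ = u₀ := by simpa using hTi 0
  have hT1 : T w₁ = u₁ := by simpa using hTi 1
  have hT2 : T w₂ = u₂ := by simpa using hTi 2
  have hnorm : ∀ x, ‖T x‖ = ‖x‖ := by
    intro x
    obtain ⟨c₀, c₁, c₂, rfl⟩ := exists_coords_of_tetra h0 h1 h2 h01 h02 h12 x
    rw [map_add, map_add, map_smul, map_smul, map_smul, hT0, hT1, hT2]
    exact norm_tetra_combo_eq h0 h1 h2 h01 h02 h12 g0 g1 g2 g01 g02 g12 c₀ c₁ c₂
  exact ⟨⟨T, hnorm⟩, hT0, hT1, hT2⟩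

/-- ★★ **ONE TRANSPORT STEP** (step (F-e) of memo NODE-g79 §5, op-norm form).  Scaled frames `G = s_k·A_k`, `H = s_l·A_l` (any linear maps); a tetrahedral unit
triple `wᵢ` of `l`'s pattern with dictionary partners `uᵢ` (a tetrahedral unit triple of `k`'s pattern differences — `…Classes.dict_gram_record`) and the three
dictionary inequalities `‖H wᵢ − G uᵢ‖ ≤ e` (`…Dict.dict_step`).  Then there is an EXACT linear isometry `R₁` with `R₁ wᵢ = uᵢ` and
`‖H x − G (R₁ x)‖ ≤ (5/2)·e·‖x‖` for EVERY `x`; chain these with `transport_compose` (errors add). [this file] -/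
theorem transport_step_exists {G H : EuclideanSpace ℝ (Fin 3) →ₗ[ℝ] EuclideanSpace ℝ (Fin 3)} {w₀ w₁ w₂ u₀ u₁ u₂ : EuclideanSpace ℝ (Fin 3)}
    (h0 : ‖w₀‖ = 1) (h1 : ‖w₁‖ = 1) (h2 : ‖w₂‖ = 1)
    (h01 : inner ℝ w₀ w₁ = 1 / 2) (h02 : inner ℝ w₀ w₂ = 1 / 2) (h12 : inner ℝ w₁ w₂ = 1 / 2)
    (g0 : ‖u₀‖ = 1) (g1 : ‖u₁‖ = 1) (g2 : ‖u₂‖ = 1)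
    (g01 : inner ℝ u₀ u₁ = 1 / 2) (g02 : inner ℝ u₀ u₂ = 1 / 2) (g12 : inner ℝ u₁ u₂ = 1 / 2)
    {e : ℝ} (hd₀ : ‖H w₀ - G u₀‖ ≤ e) (hd₁ : ‖H w₁ - G u₁‖ ≤ e) (hd₂ : ‖H w₂ - G u₂‖ ≤ e) :
    ∃ R₁ : EuclideanSpace ℝ (Fin 3) →ₗᵢ[ℝ] EuclideanSpace ℝ (Fin 3),
      R₁ w₀ = u₀ ∧ R₁ w₁ = u₁ ∧ R₁ w₂ = u₂ ∧ ∀ x, ‖H x - G (R₁ x)‖ ≤ 5 / 2 * e * ‖x‖ := by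
  obtain ⟨R₁, hR₀, hR₁, hR₂⟩ := exists_isometry_of_tetra h0 h1 h2 h01 h02 h12 g0 g1 g2 g01 g02 g12
  refine ⟨R₁, hR₀, hR₁, hR₂, ?_⟩
  have key := op_of_tetra_bound_all (M := H - G ∘ₗ R₁.toLinearMap) h0 h1 h2 h01 h02 h12 (e := e)
    (by simpa [hR₀] using hd₀) (by simpa [hR₁] using hd₁) (by simpa [hR₂] using hd₂)
  intro x
  simpa using key x

end Summit.AtomisticToContinuum.Crystallization.Theorems.OverbindingBudgetAffineCompressedCutOp
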